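import Summits.FinalStateConjecture.FinalStateConjecture.Theorems.PhotonSphereChannelsEnergyInequalities

/-!
# Route PhotonSphereChannels — the incoming-energy balance law `∂ₜ e_in − ∂ₓ p_in = V′ u²` and its
# integrated form on quadrilaterals with affinely moving ends

Helper file for stub `stub_futureSilentWavesVanish` (L) of line `isolated-kerr-connected-hull` (crux
stmt-FinalStateConjecture-14075): the first rung of any multiplier (Morawetz-type) argument towards the
missing propagation estimate H4.  For a `C²` solution `u` of `u_tt − u_xx + V u = 0` on `ℝ × ℝ` with
`V ∈ C¹`, the INCOMING null energy density `e_in = (u_t + u_x)² + V u²` and `p_in = (u_t + u_x)² − V u²`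
satisfy the balance law `∂ₜ e_in = ∂ₓ p_in + V′ u²` (`fderiv_incomingDensity_eq`; the source `V′u²` has a
sign wherever `V` is monotone), and hence, by Green's formula on the pulled-back box exactly as in
`WaveEnergy.energy_identity_affine`, the **incoming-energy identity with affinely moving ends**
(`incoming_identity_affine`): for `α(t) = a₀ + a₁ t`, `β(t) = b₀ + b₁ t`,
`∫_{α t₂}^{β t₂} e_in(t₂,·) − ∫_{α t₁}^{β t₁} e_in(t₁,·)
   = ∫_{t₁}^{t₂} [(p_in + b₁ e_in)(t, β t) − (p_in + a₁ e_in)(t, α t)] dt + ∫_{t₁}^{t₂} ∫_{α t}^{β t} V′ u² dx dt`.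
On an outgoing null end (`a₁ = 1`) the flux is `p_in + e_in = 2(u_t + u_x)²` — no `u²` term — which is what
makes the identity useful on exteriors of forward light cones (`incoming_flux_outgoing_null`).
Densities are passed as functions with defining hypotheses (`hein`, `hpin`), no definitions. [folklore]
-/

namespace Summit.FinalStateConjecture.FinalStateConjecture.Theorems

-- every `Summit.FinalStateConjecture.FinalStateConjecture.…` name repeats the summit = sub-problem
-- segment (D-0017 layout), as in every landed `…Theorems` file of this route
set_option linter.dupNamespace false

open MeasureTheory Set Filter Topology intervalIntegral

noncomputable section

namespace WaveEnergy

variable {u : ℝ × ℝ → ℝ} {V : ℝ → ℝ}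

/-- `∂ₜ e_in` along a `t`-slice: `τ ↦ e_in (τ, x)` has derivative
`2 (u_t + u_x)(u_tt + u_tx) + 2 V u u_t` (second partials as `∂²u (1,0) (·)`). -/
theorem hasDerivAt_incomingDensity_slice_fst (hu : ContDiff ℝ 2 u) {ein : ℝ × ℝ → ℝ}
    (hein : ∀ z, ein z = (fderiv ℝ u z (1, 0) + fderiv ℝ u z (0, 1)) ^ 2 + V z.2 * u z ^ 2)
    (t x : ℝ) :
    HasDerivAt (fun τ => ein (τ, x))
      (2 * (fderiv ℝ u (t, x) (1, 0) + fderiv ℝ u (t, x) (0, 1))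
          * (fderiv ℝ (fderiv ℝ u) (t, x) (1, 0) (1, 0) + fderiv ℝ (fderiv ℝ u) (t, x) (1, 0) (0, 1))
        + V x * (2 * u (t, x) * fderiv ℝ u (t, x) (1, 0))) t := by
  have h1 := hasDerivAt_fderiv_apply_slice_fst hu (1, 0) t x
  have h2 := hasDerivAt_fderiv_apply_slice_fst hu (0, 1) t x
  have h3 := hasDerivAt_slice_fst (differentiable_of_contDiff_two hu) t x
  have h := ((h1.add h2).pow 2).add ((h3.pow 2).const_mul (V x))
  have hfun : (fun τ => ein (τ, x)) = fun τ =>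
      (fderiv ℝ u (τ, x) (1, 0) + fderiv ℝ u (τ, x) (0, 1)) ^ 2 + V x * u (τ, x) ^ 2 :=
    funext fun τ => hein (τ, x)
  rw [hfun]
  refine h.congr_deriv ?_
  simp only [Pi.add_apply]
  push_cast
  ring

/-- `∂ₓ p_in` along an `x`-slice: `y ↦ p_in (t, y)` has derivative
`2 (u_t + u_x)(u_xt + u_xx) − (V′ u² + 2 V u u_x)` (second partials as `∂²u (0,1) (·)`, `V ∈ C¹`). -/
theorem hasDerivAt_incomingMomentum_slice_snd (hu : ContDiff ℝ 2 u) (hV : Differentiable ℝ V)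
    {pin : ℝ × ℝ → ℝ}
    (hpin : ∀ z, pin z = (fderiv ℝ u z (1, 0) + fderiv ℝ u z (0, 1)) ^ 2 - V z.2 * u z ^ 2)
    (t x : ℝ) :
    HasDerivAt (fun y => pin (t, y))
      (2 * (fderiv ℝ u (t, x) (1, 0) + fderiv ℝ u (t, x) (0, 1))
          * (fderiv ℝ (fderiv ℝ u) (t, x) (0, 1) (1, 0) + fderiv ℝ (fderiv ℝ u) (t, x) (0, 1) (0, 1))
        - (deriv V x * u (t, x) ^ 2 + V x * (2 * u (t, x) * fderiv ℝ u (t, x) (0, 1)))) x := by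
  have h1 := hasDerivAt_fderiv_apply_slice_snd hu (1, 0) t x
  have h2 := hasDerivAt_fderiv_apply_slice_snd hu (0, 1) t x
  have h3 := hasDerivAt_slice_snd (differentiable_of_contDiff_two hu) t x
  have hVd : HasDerivAt V (deriv V x) x := (hV x).hasDerivAt
  have h := ((h1.add h2).pow 2).sub (hVd.mul (h3.pow 2))
  have hfun : (fun y => pin (t, y)) = fun y =>
      (fderiv ℝ u (t, y) (1, 0) + fderiv ℝ u (t, y) (0, 1)) ^ 2 - V y * u (t, y) ^ 2 :=
    funext fun y => hpin (t, y)
  rw [hfun]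
  refine h.congr_deriv ?_
  simp only [Pi.add_apply, Pi.pow_apply]
  push_cast
  ring

/-- The incoming energy density is differentiable (`u ∈ C²`, `V` differentiable). -/
theorem differentiable_incomingDensity (hu : ContDiff ℝ 2 u) (hV : Differentiable ℝ V)
    {ein : ℝ × ℝ → ℝ}
    (hein : ∀ z, ein z = (fderiv ℝ u z (1, 0) + fderiv ℝ u z (0, 1)) ^ 2 + V z.2 * u z ^ 2) :
    Differentiable ℝ ein := by
  have h1 := differentiable_fderiv_apply hu (1, 0)
  have h2 := differentiable_fderiv_apply hu (0, 1)
  have h3 := differentiable_of_contDiff_two hu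
  have h4 : Differentiable ℝ (fun z : ℝ × ℝ => V z.2) := hV.comp differentiable_snd
  have : ein = fun z => (fderiv ℝ u z (1, 0) + fderiv ℝ u z (0, 1)) ^ 2 + V z.2 * u z ^ 2 :=
    funext hein
  rw [this]
  exact ((h1.add h2).pow 2).add (h4.mul (h3.pow 2))

/-- The incoming momentum density is differentiable (`u ∈ C²`, `V` differentiable). -/
theorem differentiable_incomingMomentum (hu : ContDiff ℝ 2 u) (hV : Differentiable ℝ V)
    {pin : ℝ × ℝ → ℝ}
    (hpin : ∀ z, pin z = (fderiv ℝ u z (1, 0) + fderiv ℝ u z (0, 1)) ^ 2 - V z.2 * u z ^ 2) :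
    Differentiable ℝ pin := by
  have h1 := differentiable_fderiv_apply hu (1, 0)
  have h2 := differentiable_fderiv_apply hu (0, 1)
  have h3 := differentiable_of_contDiff_two hu
  have h4 : Differentiable ℝ (fun z : ℝ × ℝ => V z.2) := hV.comp differentiable_snd
  have : pin = fun z => (fderiv ℝ u z (1, 0) + fderiv ℝ u z (0, 1)) ^ 2 - V z.2 * u z ^ 2 :=
    funext hpin
  rw [this]
  exact ((h1.add h2).pow 2).sub (h4.mul (h3.pow 2))

/-- **The incoming-energy balance law.** For a `C²` solution of `u_tt − u_xx + V u = 0` (`V ∈ C¹`),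
`∂ₜ e_in = ∂ₓ p_in + V′ u²` pointwise, i.e. `∂e_in(z)(1,0) = ∂p_in(z)(0,1) + V′(x) u(z)²`: with
`w = u_t + u_x`, `∂ₜ(w²) − ∂ₓ(w²) = 2w (u_tt − u_xx) = −2Vuw` and `(∂ₜ + ∂ₓ)(V u²) = 2Vuw + V′u²`. [folklore] -/
theorem fderiv_incomingDensity_eq (hu : ContDiff ℝ 2 u) (hV : Differentiable ℝ V)
    (hsol : ∀ z : ℝ × ℝ, fderiv ℝ (fderiv ℝ u) z (1, 0) (1, 0)
      - fderiv ℝ (fderiv ℝ u) z (0, 1) (0, 1) + V z.2 * u z = 0)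
    {ein pin : ℝ × ℝ → ℝ}
    (hein : ∀ z, ein z = (fderiv ℝ u z (1, 0) + fderiv ℝ u z (0, 1)) ^ 2 + V z.2 * u z ^ 2)
    (hpin : ∀ z, pin z = (fderiv ℝ u z (1, 0) + fderiv ℝ u z (0, 1)) ^ 2 - V z.2 * u z ^ 2)
    (z : ℝ × ℝ) :
    fderiv ℝ ein z (1, 0) = fderiv ℝ pin z (0, 1) + deriv V z.2 * u z ^ 2 := by
  obtain ⟨t, x⟩ := z
  have hE := (hasDerivAt_slice_fst (differentiable_incomingDensity hu hV hein) t x).unique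
    (hasDerivAt_incomingDensity_slice_fst hu hein t x)
  have hM := (hasDerivAt_slice_snd (differentiable_incomingMomentum hu hV hpin) t x).unique
    (hasDerivAt_incomingMomentum_slice_snd hu hV hpin t x)
  rw [hE, hM]
  have hsymm := fderiv_fderiv_symm hu (t, x) (1, 0) (0, 1)
  have hs := hsol (t, x)
  simp only at hs ⊢
  linear_combination (2 * (fderiv ℝ u (t, x) (1, 0) + fderiv ℝ u (t, x) (0, 1))) * hs
    + (2 * (fderiv ℝ u (t, x) (1, 0) + fderiv ℝ u (t, x) (0, 1))) * hsymm

/-- On an outgoing null end the incoming flux `p_in + e_in = 2 (u_t + u_x)²` carries no `u²` term.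
[folklore] -/
theorem incoming_flux_outgoing_null {ein pin : ℝ × ℝ → ℝ}
    (hein : ∀ z, ein z = (fderiv ℝ u z (1, 0) + fderiv ℝ u z (0, 1)) ^ 2 + V z.2 * u z ^ 2)
    (hpin : ∀ z, pin z = (fderiv ℝ u z (1, 0) + fderiv ℝ u z (0, 1)) ^ 2 - V z.2 * u z ^ 2)
    (z : ℝ × ℝ) :
    pin z + 1 * ein z = 2 * (fderiv ℝ u z (1, 0) + fderiv ℝ u z (0, 1)) ^ 2 := by
  rw [hein, hpin]
  ring

/-- On an ingoing null end the incoming flux is `p_in − e_in = −2 V u² ≤ 0` for `V ≥ 0`. [folklore] -/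
theorem incoming_flux_ingoing_null {ein pin : ℝ × ℝ → ℝ}
    (hein : ∀ z, ein z = (fderiv ℝ u z (1, 0) + fderiv ℝ u z (0, 1)) ^ 2 + V z.2 * u z ^ 2)
    (hpin : ∀ z, pin z = (fderiv ℝ u z (1, 0) + fderiv ℝ u z (0, 1)) ^ 2 - V z.2 * u z ^ 2)
    (z : ℝ × ℝ) :
    pin z + (-1) * ein z = -(2 * (V z.2 * u z ^ 2)) := by
  rw [hein, hpin]
  ring

/-- The incoming densities and the source are continuous (`u ∈ C²`, `V ∈ C¹`). -/
theorem continuous_incomingSource (hu : ContDiff ℝ 2 u) (hV : ContDiff ℝ 1 V) {src : ℝ × ℝ → ℝ}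
    (hsrc : ∀ z, src z = deriv V z.2 * u z ^ 2) : Continuous src := by
  have : src = fun z => deriv V z.2 * u z ^ 2 := funext hsrc
  rw [this]
  exact ((hV.continuous_deriv le_rfl).comp continuous_snd).mul
    ((differentiable_of_contDiff_two hu).continuous.pow 2)

/-- **Incoming-energy identity with affinely moving ends.** Let `u` be a `C²` solution of
`u_tt − u_xx + V u = 0` on `ℝ × ℝ` with `V ∈ C¹`, `e_in = (u_t + u_x)² + V u²`, `p_in = (u_t + u_x)² − V u²`
and `src = V′ u²` (hypotheses `hein`, `hpin`, `hsrc`). For the moving interval `[α(t), β(t)]`,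
`α(t) = a₀ + a₁ t`, `β(t) = b₀ + b₁ t`:
`∫_{α t₂}^{β t₂} e_in(t₂,·) − ∫_{α t₁}^{β t₁} e_in(t₁,·)
  = ∫_{t₁}^{t₂} [(p_in + b₁ e_in)(t, β t) − (p_in + a₁ e_in)(t, α t)] dt + ∫_{t₁}^{t₂} ∫_{α t}^{β t} src(t, x) dx dt`
(oriented integrals, no ordering hypotheses).  Proof: Green's formula on the box `[t₁,t₂] × [0,1]` for the
pulled-back pair `F = L e_in(t, X)`, `G = −(p_in(t,X) + ∂ₜX · e_in(t,X))`, `X = α + Lθ`, `L = β − α`, whose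
divergence is `L · (∂ₜ e_in − ∂ₓ p_in) ∘ X = L · src ∘ X` by the balance law. [folklore] -/
theorem incoming_identity_affine (hu : ContDiff ℝ 2 u) (hV : ContDiff ℝ 1 V)
    (hsol : ∀ z : ℝ × ℝ, fderiv ℝ (fderiv ℝ u) z (1, 0) (1, 0)
      - fderiv ℝ (fderiv ℝ u) z (0, 1) (0, 1) + V z.2 * u z = 0)
    {ein pin src : ℝ × ℝ → ℝ}
    (hein : ∀ z, ein z = (fderiv ℝ u z (1, 0) + fderiv ℝ u z (0, 1)) ^ 2 + V z.2 * u z ^ 2)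
    (hpin : ∀ z, pin z = (fderiv ℝ u z (1, 0) + fderiv ℝ u z (0, 1)) ^ 2 - V z.2 * u z ^ 2)
    (hsrc : ∀ z, src z = deriv V z.2 * u z ^ 2)
    (a₀ a₁ b₀ b₁ t₁ t₂ : ℝ) :
    (∫ x in (a₀ + a₁ * t₂)..(b₀ + b₁ * t₂), ein (t₂, x))
        - ∫ x in (a₀ + a₁ * t₁)..(b₀ + b₁ * t₁), ein (t₁, x)
      = (∫ t in t₁..t₂, ((pin (t, b₀ + b₁ * t) + b₁ * ein (t, b₀ + b₁ * t))
          - (pin (t, a₀ + a₁ * t) + a₁ * ein (t, a₀ + a₁ * t))))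
        + ∫ t in t₁..t₂, ∫ x in (a₀ + a₁ * t)..(b₀ + b₁ * t), src (t, x) := by
  have hVd : Differentiable ℝ V := hV.differentiable one_ne_zero
  have hed := differentiable_incomingDensity hu hVd hein
  have hmd := differentiable_incomingMomentum hu hVd hpin
  have hec := hed.continuous
  have hmc := hmd.continuous
  have hsc := continuous_incomingSource hu hV hsrc
  have hcons : ∀ z, fderiv ℝ ein z (1, 0) = fderiv ℝ pin z (0, 1) + src z := fun z => by
    rw [fderiv_incomingDensity_eq hu hVd hsol hein hpin z, hsrc z]
  -- the pulled-back pair on the box `[t₁, t₂] × [0, 1]`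
  set F : ℝ × ℝ → ℝ := fun p =>
    (b₀ + b₁ * p.1 - (a₀ + a₁ * p.1)) * ein (p.1, (b₀ + b₁ * p.1 - (a₀ + a₁ * p.1)) * p.2
      + (a₀ + a₁ * p.1)) with hF
  set G : ℝ × ℝ → ℝ := fun p =>
    -(pin (p.1, (b₀ + b₁ * p.1 - (a₀ + a₁ * p.1)) * p.2 + (a₀ + a₁ * p.1))
      + (a₁ + (b₁ - a₁) * p.2) * ein (p.1, (b₀ + b₁ * p.1 - (a₀ + a₁ * p.1)) * p.2
        + (a₀ + a₁ * p.1))) with hG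
  have hFd : Differentiable ℝ F := by
    simp only [hF]
    fun_prop
  have hGd : Differentiable ℝ G := by
    simp only [hG]
    fun_prop
  -- divergence of `(F, G)` is `L · src ∘ X`
  have hdiv : ∀ t θ : ℝ, fderiv ℝ F (t, θ) (1, 0) + fderiv ℝ G (t, θ) (0, 1)
      = (b₀ + b₁ * t - (a₀ + a₁ * t))
        * src (t, (b₀ + b₁ * t - (a₀ + a₁ * t)) * θ + (a₀ + a₁ * t)) := by
    intro t θ
    have haff : ∀ (p q s : ℝ), HasDerivAt (fun τ : ℝ => p + q * τ) q s := fun p q s => by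
      simpa using ((hasDerivAt_id s).const_mul q).const_add p
    have hL : HasDerivAt (fun τ : ℝ => b₀ + b₁ * τ - (a₀ + a₁ * τ)) (b₁ - a₁) t :=
      (haff b₀ b₁ t).fun_sub (haff a₀ a₁ t)
    have hX : HasDerivAt (fun τ : ℝ => (b₀ + b₁ * τ - (a₀ + a₁ * τ)) * θ + (a₀ + a₁ * τ))
        ((b₁ - a₁) * θ + a₁) t :=
      (hL.mul_const θ).fun_add (haff a₀ a₁ t)
    have hγ : HasDerivAt (fun τ : ℝ => (τ, (b₀ + b₁ * τ - (a₀ + a₁ * τ)) * θ + (a₀ + a₁ * τ)))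
        ((1 : ℝ), (b₁ - a₁) * θ + a₁) t := (hasDerivAt_id' t).prodMk hX
    have hY : HasDerivAt (fun θ' : ℝ => (b₀ + b₁ * t - (a₀ + a₁ * t)) * θ' + (a₀ + a₁ * t))
        (b₀ + b₁ * t - (a₀ + a₁ * t)) θ := by
      simpa using ((hasDerivAt_id θ).const_mul (b₀ + b₁ * t - (a₀ + a₁ * t))).add_const
        (a₀ + a₁ * t)
    have hδ : HasDerivAt (fun θ' : ℝ => (t, (b₀ + b₁ * t - (a₀ + a₁ * t)) * θ' + (a₀ + a₁ * t)))
        ((0 : ℝ), (b₀ + b₁ * t - (a₀ + a₁ * t))) θ := (hasDerivAt_const θ t).prodMk hY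
    have hcoef : HasDerivAt (fun θ' : ℝ => a₁ + (b₁ - a₁) * θ') (b₁ - a₁) θ := haff a₁ (b₁ - a₁) θ
    set Xv : ℝ := (b₀ + b₁ * t - (a₀ + a₁ * t)) * θ + (a₀ + a₁ * t) with hXv
    have hFs : HasDerivAt (fun τ => F (τ, θ))
        ((b₁ - a₁) * ein (t, Xv) + (b₀ + b₁ * t - (a₀ + a₁ * t))
          * fderiv ℝ ein (t, Xv) ((1 : ℝ), (b₁ - a₁) * θ + a₁)) t := by
      have h := hL.fun_mul (hasDerivAt_comp_curve hed hγ)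
      exact h
    have hGs : HasDerivAt (fun θ' => G (t, θ'))
        (-(fderiv ℝ pin (t, Xv) ((0 : ℝ), (b₀ + b₁ * t - (a₀ + a₁ * t)))
          + ((b₁ - a₁) * ein (t, Xv)
            + (a₁ + (b₁ - a₁) * θ)
              * fderiv ℝ ein (t, Xv) ((0 : ℝ), (b₀ + b₁ * t - (a₀ + a₁ * t)))))) θ := by
      have h := ((hasDerivAt_comp_curve hmd hδ).fun_add
        (hcoef.fun_mul (hasDerivAt_comp_curve hed hδ))).fun_neg
      exact h
    have h1 := (hasDerivAt_slice_fst hFd t θ).unique hFs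
    have h2 := (hasDerivAt_slice_snd hGd t θ).unique hGs
    rw [h1, h2, clm_apply_one_snd (fderiv ℝ ein (t, Xv)) ((b₁ - a₁) * θ + a₁),
      clm_apply_zero_snd (fderiv ℝ pin (t, Xv)) (b₀ + b₁ * t - (a₀ + a₁ * t)),
      clm_apply_zero_snd (fderiv ℝ ein (t, Xv)) (b₀ + b₁ * t - (a₀ + a₁ * t)), hcons (t, Xv)]
    ring
  -- Green's formula on the box
  have hdivfun : (fun z : ℝ × ℝ => fderiv ℝ F z (1, 0) + fderiv ℝ G z (0, 1)) = fun z =>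
      (b₀ + b₁ * z.1 - (a₀ + a₁ * z.1))
        * src (z.1, (b₀ + b₁ * z.1 - (a₀ + a₁ * z.1)) * z.2 + (a₀ + a₁ * z.1)) :=
    funext fun z => hdiv z.1 z.2
  have hdivc : Continuous fun z : ℝ × ℝ =>
      (b₀ + b₁ * z.1 - (a₀ + a₁ * z.1))
        * src (z.1, (b₀ + b₁ * z.1 - (a₀ + a₁ * z.1)) * z.2 + (a₀ + a₁ * z.1)) := by
    fun_prop
  have key := integral2_divergence_prod_of_hasFDerivAt F G (fderiv ℝ F) (fderiv ℝ G) t₁ 0 t₂ 1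
    hFd.continuous.continuousOn hGd.continuous.continuousOn
    (fun z _ => (hFd z).hasFDerivAt) (fun z _ => (hGd z).hasFDerivAt)
    (by
      rw [hdivfun]
      exact hdivc.continuousOn.integrableOn_compact (isCompact_uIcc.prod isCompact_uIcc))
  have hlhs : (∫ t in t₁..t₂, ∫ θ in (0 : ℝ)..1,
      fderiv ℝ F (t, θ) (1, 0) + fderiv ℝ G (t, θ) (0, 1))
      = ∫ t in t₁..t₂, ∫ x in (a₀ + a₁ * t)..(b₀ + b₁ * t), src (t, x) := by
    refine intervalIntegral.integral_congr fun t _ => ?_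
    simp only [hdiv]
    rw [intervalIntegral.integral_const_mul,
      intervalIntegral.mul_integral_comp_mul_add (f := fun x => src (t, x))]
    congr 1 <;> ring
  rw [hlhs] at key
  -- evaluate the four boundary terms
  have hG1 : ∀ t, G (t, 1) = -(pin (t, b₀ + b₁ * t) + b₁ * ein (t, b₀ + b₁ * t)) := by
    intro t
    have h1 : (b₀ + b₁ * t - (a₀ + a₁ * t)) * 1 + (a₀ + a₁ * t) = b₀ + b₁ * t := by ring
    have h2 : a₁ + (b₁ - a₁) * 1 = b₁ := by ring
    simp only [hG, h1, h2]
  have hG0 : ∀ t, G (t, 0) = -(pin (t, a₀ + a₁ * t) + a₁ * ein (t, a₀ + a₁ * t)) := by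
    intro t
    have h1 : (b₀ + b₁ * t - (a₀ + a₁ * t)) * 0 + (a₀ + a₁ * t) = a₀ + a₁ * t := by ring
    have h2 : a₁ + (b₁ - a₁) * 0 = a₁ := by ring
    simp only [hG, h1, h2]
  have hFint : ∀ t, (∫ θ in (0 : ℝ)..1, F (t, θ))
      = ∫ x in (a₀ + a₁ * t)..(b₀ + b₁ * t), ein (t, x) := by
    intro t
    simp only [hF]
    rw [intervalIntegral.integral_const_mul,
      intervalIntegral.mul_integral_comp_mul_add (f := fun x => ein (t, x))]
    congr 1 <;> ring
  rw [hFint, hFint] at key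
  simp_rw [hG1, hG0] at key
  have hi1 : IntervalIntegrable (fun t => -(pin (t, b₀ + b₁ * t) + b₁ * ein (t, b₀ + b₁ * t)))
      volume t₁ t₂ := by
    apply Continuous.intervalIntegrable
    fun_prop
  have hi0 : IntervalIntegrable (fun t => -(pin (t, a₀ + a₁ * t) + a₁ * ein (t, a₀ + a₁ * t)))
      volume t₁ t₂ := by
    apply Continuous.intervalIntegrable
    fun_prop
  have hsub := intervalIntegral.integral_sub hi0 hi1
  have hcongr : (∫ t in t₁..t₂, ((pin (t, b₀ + b₁ * t) + b₁ * ein (t, b₀ + b₁ * t))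
      - (pin (t, a₀ + a₁ * t) + a₁ * ein (t, a₀ + a₁ * t))))
      = ∫ t in t₁..t₂, (-(pin (t, a₀ + a₁ * t) + a₁ * ein (t, a₀ + a₁ * t))
        - -(pin (t, b₀ + b₁ * t) + b₁ * ein (t, b₀ + b₁ * t))) := by
    congr 1
    funext t
    ring
  rw [hcongr, hsub]
  linarith

/-- **Registered sub-goal `stub_futureSilentWavesVanish_R1` of stub L** (crux
stmt-FinalStateConjecture-14075, line `isolated-kerr-connected-hull`): the incoming-energy identity with
affinely moving ends, first rung of the multiplier route to the missing propagation estimate H4.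
[folklore] -/
theorem stub_futureSilentWavesVanish_R1 :
    ∀ (u : ℝ × ℝ → ℝ) (V : ℝ → ℝ), ContDiff ℝ 2 u → ContDiff ℝ 1 V →
      (∀ z : ℝ × ℝ, fderiv ℝ (fderiv ℝ u) z (1, 0) (1, 0)
        - fderiv ℝ (fderiv ℝ u) z (0, 1) (0, 1) + V z.2 * u z = 0) →
      ∀ (ein pin src : ℝ × ℝ → ℝ),
        (∀ z, ein z = (fderiv ℝ u z (1, 0) + fderiv ℝ u z (0, 1)) ^ 2 + V z.2 * u z ^ 2) →
        (∀ z, pin z = (fderiv ℝ u z (1, 0) + fderiv ℝ u z (0, 1)) ^ 2 - V z.2 * u z ^ 2) →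
        (∀ z, src z = deriv V z.2 * u z ^ 2) →
        ∀ (a₀ a₁ b₀ b₁ t₁ t₂ : ℝ),
          (∫ x in (a₀ + a₁ * t₂)..(b₀ + b₁ * t₂), ein (t₂, x))
              - ∫ x in (a₀ + a₁ * t₁)..(b₀ + b₁ * t₁), ein (t₁, x)
            = (∫ t in t₁..t₂, ((pin (t, b₀ + b₁ * t) + b₁ * ein (t, b₀ + b₁ * t))
                - (pin (t, a₀ + a₁ * t) + a₁ * ein (t, a₀ + a₁ * t))))
              + ∫ t in t₁..t₂, ∫ x in (a₀ + a₁ * t)..(b₀ + b₁ * t), src (t, x) :=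
  fun _ _ hu hV hsol _ _ _ hein hpin hsrc ↦ incoming_identity_affine hu hV hsol hein hpin hsrc

end WaveEnergy

end

end Summit.FinalStateConjecture.FinalStateConjecture.Theorems
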